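import Summits.HodgeConjecture.HodgeConjecture.Theses.MilnorKExponential
import Literature.AlgebraicGeometry.HodgeTheory.SymbolClasses
import Literature.AlgebraicGeometry.HodgeTheory.HodgeTypeDimension
import Literature.NumberTheory.Transcendental.ComplexFormsHighType
-- gen 2 (cycle 1): the landed Negative lane of this crux (all ACCEPTED, axioms standard)
import Summits.HodgeConjecture.HodgeConjecture.Theorems.SymbolClassesAlgebraic.Negative.LineCeiling
import Summits.HodgeConjecture.HodgeConjecture.Theorems.SymbolClassesAlgebraic.Negative.BandAntiVacuity
import Summits.HodgeConjecture.HodgeConjecture.Theorems.SymbolClassesAlgebraic.Negative.TranscendentalWitness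

/-!
# Disproof of `SymbolClassesAlgebraic` (GK_p, stmt-HodgeConjecture-17743) — findings

Standing disprover's work file (refuter-cdisprove-stmt-HodgeConjecture-17743-0, cycle 1,
2026-08-17). Crux (route `MilnorKExponential`, rank 2): on a smooth projective complex `n`-fold every
RATIONAL symbol class of weight `p = q + 1` — a class `c ∈ H^{2p}(X(ℂ); ℂ)` such that, on SOME Hodge
model `A` whose de Rham comparison is symbol-normalised in degree `2p` (`A.IsSymbolNormalized q`), a
non-zero integer multiple of `A^* c` is the Čech–de Rham transgression of a Čech `p`-cocycle of
holomorphic Milnor symbols (`A.HasSymbolCocycle q c`) — lies in `algebraicClasses X p = Nᵖ H^{2p}`.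

VERDICT OF THIS CYCLE: **no kill; the crux resists for a structural reason** (§1): given the route's
own typing support item `SymbolClassesHodgeType` (`L ⊆ Hdg`, stmt-17746: transgressions of cocycles of
closed holomorphic `p`-forms lie in `F^p`, and rational ∩ `F^p H^{2p}` = Hodge classes), the Hodge
conjecture IMPLIES the crux (`crux_of_hodgeConjecture`), so every refutation of the crux refutes
`HodgeConjecture ∧ SymbolClassesHodgeType` (`not_hodgeConjecture_of_not_crux`). A `¬ SymbolClassesAlgebraic`
theorem is therefore out of reach short of a counterexample to HC (or a typing bug in `L ⊆ Hdg`, which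
the symbol-by-symbol read-back below does not find).

FINDINGS (all sorry-free; the letters are the cdisprove index):

* §0 `crux_iff_gk` — the inlined route decl is, componentwise definitionally, the named statement over
  `HodgeModel.IsSymbolNormalized` / `HodgeModel.HasSymbolCocycle` of
  `Literature/AlgebraicGeometry/HodgeTheory/SymbolClasses` (read-back: no coercion junk; `Rel ∅ = ⊤`
  and degenerate ordered tuples harmless; the zig-zag `Tr` is `IsTransgression` verbatim; the only
  `ℕ`-arithmetic is `2 * (q + 1) ≡ 2 * q + 1 + 1`, definitional).
* §1 CEILING (why it resists): `crux_of_hodgeConjecture`, `not_hodgeConjecture_of_not_crux`.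
* §2 (b) BOUNDARY: the crux has content only for `q + 1 ≤ n`. Above the dimension NO model is
  symbol-normalised (`not_isSymbolNormalized_of_lt`: there are no non-zero `(2q+2)`-forms on the real
  `2n`-manifold `X^an`, so `θ₀ = 0` and `c₀ = 0`), every class with a symbol cocycle is `0`
  (`eq_zero_of_hasSymbolCocycle_of_lt`), and the crux HOLDS there outright (`crux_of_lt`) — unlike the
  census lemma `gkNamed_above_dim`, without the support item `L ⊆ Hdg`.
* §3 (a) LOAD-BEARING `m ≠ 0`: with the integer multiple unrestricted, `m = 0`, `σ = 0`, `θ = 0` is a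
  symbol cocycle for EVERY class (`hasSymbolCocycleAnyMultiple`), so the weakened crux is EQUIVALENT to
  "every rational class of a normalisable degree is algebraic" (`gkWithoutNonzero_iff`), false on any
  abelian or K3 surface in degree 2 (`gkWithoutNonzero_false_of`, modulo that witness, which the tree
  cannot yet construct on its own carriers).
* §4 (a) LOAD-BEARING "the cover covers" (`∀ x, ∃ i, x ∈ U i`): on the EMPTY cover (index type
  `Empty`, finite) every cochain condition is vacuous, so every closed form "transgresses" and every
  class has a symbol cocycle with `m = 1` (`hasSymbolCocycleNoCover`); the weakened crux is again
  equivalent to "every rational class is algebraic" (`gkWithoutCover_iff`, `gkWithoutCover_false_of`).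
  Any proof must use `hcov` — it is the only clause tying `θ` to the symbol data.
* §5 MUTATION, hypotheses that are NOT load-bearing for the truth value (information for provers):
  dropping the normalisation clause or `Fintype ι` only STRENGTHENS the statement
  (`crux_of_gkWithoutNorm`, `crux_of_gkWithoutFintype`: trivial directions; the converses are the
  census's S⁺₁ ⟺ GK, via uniqueness of analytification and the scalar rigidity of natural de Rham
  comparisons — not provable here); `IsRationalClass c` is invisible because `algebraicClasses` is a
  `ℂ`-subspace (`smul_mem_algebraicClasses_of_crux`); the "cocycle modulo `milnorRel`" clause is
  implied ON THE NOSE at the level of forms by the transgression (`δ w = δ δ Z = 0` on `U_{J'}`), so it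
  constrains the class only through K-theory, not through de Rham theory (docstring of §5).
* §6 ANTI-VACUITY modulo normalisation, weight 1: a normalisation witness `(L, θ₀, c₀)` in degree 2 is
  itself a symbol cocycle (`exists_ne_zero_hasSymbolCocycle_of_isSymbolNormalized_zero`, using
  `HolomorphicLineBundle.isMilnorSymbolCocycle_symbolCochain_zero`), so on a normalised model the crux in weight 1 speaks about
  a NON-ZERO rational class (it is Lefschetz (1,1) + GAGA there). For `q ≥ 1` the same needs the cocycle
  property of the cup powers `L.symbolCochain q` (Leibniz for the Čech cup product; not in the tree).
* §7 NEAR-MISSES / refuted strengthenings on paper (docstrings, with the catalogued barriers):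
  Kähler GK is false (Zucker 1977 / Voisin 2002 tori: `Literature.Barriers.HodgeConjecture.
  Zucker1977_kaehlerTorus_noAnalyticCycles`, `…Voisin2002_weilTorus_hodgeClassWithoutSubvarieties`) but
  the crux quantifies over SCHEMES, and a smooth proper `ℂ`-scheme with Kähler analytification is
  projective (Moishezon), so "projective" cannot be shown load-bearing inside this signature; integral GK
  (`m = 1`) is false (Kollár 1992, `…Kollar1992_nonTorsionClass_notAlgebraic`; 2001 Thm 7.4) — `m ≠ 0`
  with `∃ m` is exactly right; dropping holomorphy of the units makes every integral class of `H²` a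
  weight-1 "symbol class" (smooth line bundles), false on abelian surfaces, but no smooth Čech datum is
  constructible here (near-miss, recorded as prose only — no `sorry` kept).
* §8 DE-RHAM-INVISIBLE COCYCLES (census loophole (iv), now CHECKED in weight 1): a weight-1 symbol
  cocycle whose symbol forms vanish on the `U_J` (constants, `ker dlog`) carries only `c = 0`
  (`eq_zero_of_invisible_symbolCocycle_one`, via `exists_mextDeriv_eq_of_isTransgression_zero_zero`:
  a transgression of the zero cochain over a cover is exact, by gluing the column-`0` cochain).

GEN 2, CYCLE 1 (refuter-cdisprove-stmt-HodgeConjecture-17743-g2-0, 2026-08-17) — ADDENDA §9–§12, all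
sorry-free, the theorems LANDED under `Theorems/SymbolClassesAlgebraic/Negative/` and re-exported here:

* §9 LINE `NashDescentSketch` (the lead's picked line, skeleton v3, three band stubs; `Negative/LineCeiling`,
  p162046). NECESSITY: the weight stubs (W₁-band: rational Nash symbol classes of weight 2 die off a
  proper closed subset, `n ≥ 4`; W_alg-band: rational Nash symbol classes of weight `3 ≤ q+1 ≤ n-2` are
  algebraic) are CONSEQUENCES OF THE CRUX (`line_not_crux_of_not_highBand`, `line_not_crux_of_not_weightTwoBand`:
  Nash ⊆ symbol, `N² ⊆ N¹`), and the descent stub (A-band: symbol ⇒ Nash symbol) is a consequence of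
  the crux given the Nash typing `Alg ⊆ L_Nash` (`line_not_crux_of_not_descentBand`). CEILING: hence every
  stub is below HC (`line_not_hodgeConjecture_of_not_*`; A modulo `Alg ⊆ L_Nash`). MUTATION: in W₁-band
  the guards `4 ≤ n` and `IsRationalClass c` are not load-bearing (outside them the statement is the
  landed unconditional slices resp. invisible to a `ℂ`-subspace conclusion); dropping Nash-ness gives
  exactly coniveau one for symbol classes = GK₂ (crux strength, not refutable); in A-band dropping
  `IsSymbolClass` gives "every rational class is Nash-symbol", false by §11's witness; the band guards
  only cut away proved slices. DEGENERATE CASES: the empty scheme is excluded (`GeometricallyIrreducible`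
  ⇒ non-empty, `line_nonempty`), so the clause `Z ≠ univ` of W₁-band is consistent (`line_dieOffClosed_zero`).
  JOINT SUFFICIENCY is Lean-certified by the lead (`SymbolClassesAlgebraic_of`). VERDICT ON THE LINE: no
  stub is misstated; none is refutable short of ¬HC, except (A) through a failure of the NASH TYPING —
  `AlgebraicClassesAreNashSymbolClasses` is the line's one cheap falsifier and nobody has tested it:
  `IsNashUnitOn` has NO API in the tree (not even `1` is shown Nash; closure under products/inverses,
  which `nashMilnorRel` witnesses need, wants resultants over the ring of regular germs).
* §10 ANTI-VACUITY IN THE WHOLE BAND (`Negative/BandAntiVacuity`, p162110): the cup powers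
  `L.symbolCochain q` are Milnor symbol cocycles for EVERY `q` (was `q = 0`), so every normalisation
  witness is a symbol cocycle for a non-zero rational class, and with `SymbolLiftR.normalisedModelsExist`
  the crux's hypothesis is met by a NON-ZERO rational class in every `(n, q+1)`, `1 ≤ q+1 ≤ n`
  (`band_exists_ne_zero_isSymbolClass`, `band_exists_ne_zero_routeHypothesis`). GK is nowhere vacuous
  in its band; outside it is empty (§2).
* §11 THE TRANSCENDENTAL WITNESS, ON THE TREE'S CARRIERS (`Negative/TranscendentalWitness`, p162689):
  `E_i³ = cubeScheme i` carries a RATIONAL class of `H²` NOT of Hodge type `(1,1)`, hence NOT ALGEBRAIC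
  (`witness_exists_isRationalClass_not_isOfHodgeType`, `witness_exists_isRationalClass_not_mem_algebraicClasses`;
  scale-invariant argument: were all rational classes `(1,1)`, rational classes spanning `H²` and the type
  being testable on the torus model, `H^{1,1}` of the torus would be everything, but `[dz₀ ∧ dz₁] ≠ 0`
  lies in `H^{2,0}`). CONSEQUENCE: §3/§4 are now UNCONDITIONAL — `not_rationalClassesAlgebraic`,
  `not_gkWithoutNonzero`, `not_gkWithoutCover`: the crux with `m ≠ 0` deleted, or with the covering
  clause deleted, is FALSE. (The same witness discharges the `hw` hypotheses of the sibling disprovers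
  of `AnchorExistence`, `OrthogonalEnveloped`, `BallQuotientHodgeAbsolute`.)
* §12 WHAT WOULD CHANGE THE VERDICT (prose): (i) a counterexample to formal HC (none in sight: model
  independence `hodgePQ_independent_of_hodgeModel_holds` and `IsAnalytification.unique` close the
  exotic-model loophole; §11 shows the statement is not trivially true either); (ii) for the LINE only:
  `Alg ⊆ L_Nash` false — test: is `h² ∈ H⁴(ℙ⁴)` a NASH symbol class via the regular cocycle `x_j/x_i`
  (needs `IsNashUnitOn` of regular units + a Hermitian metric on that presentation + `isTransgression_symbolCochain`)?
  (iii) nothing else: every other mutation is either proved true, crux-strength, or refuted here.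

VERDICT OF GEN 2, CYCLE 1: **no kill** — the crux and all three stubs of the picked line sit below the
(formal) Hodge conjecture by Lean-certified implications; the disprover's deliverable is the negative
lane: 6 files landed (gen 1: Ceiling, LoadBearing, InvisibleCocycle; gen 2: LineCeiling, BandAntiVacuity,
TranscendentalWitness), the last making the load-bearing analysis unconditional.

How to read this file if you are a PROVER: the only hypotheses you can lean on are projectivity (enters
through GAGA/Chow or Lefschetz (1,1) after a support reduction), `m ≠ 0` (saturation), the covering
clause (it is what makes `θ` represent the Čech class of the symbol forms) and holomorphy of the units
(puts the class in `F^p`); normalisation, finiteness of the cover, rationality of `c` and the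
`milnorRel`-cocycle clause give you nothing about the de Rham class beyond what `IsTransgression`
already says. The first open case is `(n, p) = (4, 2)`; by §1 any counterexample is a counterexample to
the Hodge conjecture.
-/

noncomputable section

-- The mandated namespace repeats `HodgeConjecture` (single-conjunct summit).
set_option linter.dupNamespace false

namespace Summit.HodgeConjecture.HodgeConjecture.Cruxes.SymbolClassesAlgebraic.Disproof

open scoped Manifold Topology ContDiff
open Filter Set
open Literature.AlgebraicGeometry.HodgeTheory Literature.AlgebraicGeometry.Motives
  Literature.Geometry.Kaehler Literature.NumberTheory.Transcendental
open Summit.HodgeConjecture.HodgeConjecture.Theses.MilnorKExponential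
  (SymbolClassesAlgebraic SymbolClassesHodgeType)

/-! ### §0 The crux in named form -/

/-- GK_p in NAMED form, exactly the route's shape (unguarded normalisation clause): a rational class
with a symbol cocycle on a symbol-normalised Hodge model is algebraic. [folklore] -/
def GK : Prop :=
  ∀ ⦃n : ℕ⦄ ⦃X : SchemeOver ℂ⦄, IsSmoothProjective n X →
    ∀ (q : ℕ) (c : complexBetti X (2 * (q + 1))), IsRationalClass c →
      (∃ A : HodgeModel n X, A.IsSymbolNormalized q ∧ A.HasSymbolCocycle q c) →
        c ∈ algebraicClasses X (q + 1)

/-- **Read-back**: the inlined route decl `SymbolClassesAlgebraic` IS `GK` (componentwise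
definitional; the two cocycle clauses are bundled as `IsMilnorSymbolCocycle`). [folklore] -/
theorem crux_iff_gk : SymbolClassesAlgebraic ↔ GK := by
  constructor
  · rintro h n X hX q c hc ⟨A, hN, ι, hι, U, hU, hcov, σ, ⟨hg, hco⟩, θ, m, hm, hT, hdR⟩
    exact h hX q c hc ⟨A, hN, ι, hι, U, hU, hcov, σ, hg, hco, θ, m, hm, hT, hdR⟩
  · rintro h n X hX q c hc ⟨A, hN, ι, hι, U, hU, hcov, σ, hg, hco, θ, m, hm, hT, hdR⟩
    exact h hX q c hc ⟨A, hN, ι, hι, U, hU, hcov, σ, ⟨hg, hco⟩, θ, m, hm, hT, hdR⟩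

/-! ### §1 Ceiling: the Hodge conjecture implies the crux (given the typing item `L ⊆ Hdg`) -/

/-- **HC ∧ (L ⊆ Hdg) ⇒ GK.** A rational symbol class is of Hodge type `(p,p)` by the route's support
item `SymbolClassesHodgeType`, hence algebraic under the Hodge conjecture. So the crux sits BELOW the
summit: it can only be refuted by refuting `HodgeConjecture ∧ SymbolClassesHodgeType`.
[cite: VoisinHodgeI2002, §7.1.1 and §11.3] -/
theorem crux_of_hodgeConjecture (hT : SymbolClassesHodgeType) (hHC : _root_.HodgeConjecture) :
    SymbolClassesAlgebraic := by
  intro n X hX q c hc hs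
  exact (hHC hX).2 (q + 1) c hc (hT hX q c hc hs)

/-- **`¬ GK ⇒ ¬ HC`** (given `L ⊆ Hdg`): the contrapositive of `crux_of_hodgeConjecture` — every
counterexample to the crux is a counterexample to the Hodge conjecture. [cite: Deligne2000, §1] -/
theorem not_hodgeConjecture_of_not_crux (hT : SymbolClassesHodgeType) (h : ¬ SymbolClassesAlgebraic) :
    ¬ _root_.HodgeConjecture :=
  fun hHC ↦ h (crux_of_hodgeConjecture hT hHC)

/-! ### §2 Boundary: above the dimension the hypothesis is empty and the crux holds outright -/

variable {n : ℕ} {X : SchemeOver ℂ}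

/-- **No Hodge model is symbol-normalised in a degree `2(q+1) > 2n`**: the normalising form `θ₀` is a
`(2q+2)`-form on a real `2n`-manifold, hence `0` (`mform_eq_zero_of_two_mul_finrank_lt` with
`dim_ℂ A.model = n`), so `A^* c₀ = A.deRham [0] = 0` and `c₀ = 0` (`pullback_injective`),
contradicting `c₀ ≠ 0`. [cite: VoisinHodgeI2002, §2.3.1] -/
theorem not_isSymbolNormalized_of_lt (A : HodgeModel n X) {q : ℕ} (hq : n < q + 1) :
    ¬ A.IsSymbolNormalized q := by
  rintro ⟨ι, _, L, θ₀, c₀, _, _, hc₀, hdR⟩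
  have hθ : θ₀ = 0 :=
    Subtype.ext (mform_eq_zero_of_two_mul_finrank_lt _ (by rw [A.isAnalytification.finrank_eq]; omega))
  refine hc₀ (A.pullback_injective (2 * q + 1 + 1) ?_)
  rw [← hdR, hθ, map_zero, map_zero, map_zero]

/-- **Above the dimension only `0` carries a symbol cocycle**: `θ = 0` for the same reason, so
`m • A^* c = 0` with `m ≠ 0`, i.e. `c = 0`. [cite: VoisinHodgeI2002, §2.3.1] -/
theorem eq_zero_of_hasSymbolCocycle_of_lt (A : HodgeModel n X) {q : ℕ} (hq : n < q + 1)
    {c : complexBetti X (2 * (q + 1))} (h : A.HasSymbolCocycle q c) : c = 0 := by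
  obtain ⟨ι, _, U, hU, hcov, σ, hσ, θ, m, hm, hT, hdR⟩ := h
  have hθ : θ = 0 :=
    Subtype.ext (mform_eq_zero_of_two_mul_finrank_lt _ (by rw [A.isAnalytification.finrank_eq]; omega))
  rw [hθ, map_zero, map_zero, eq_comm, smul_eq_zero] at hdR
  rcases hdR with hm0 | h0
  · exact absurd (Int.cast_eq_zero.1 hm0) hm
  · exact A.pullback_injective (2 * q + 1 + 1) (by rw [h0, map_zero])

/-- **The crux holds outright in every degree `2(q+1) > 2n`** (its hypothesis is even unsatisfiable
there, `not_isSymbolNormalized_of_lt`; and a class with a symbol cocycle is `0`, which is algebraic).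
So proofs and disproofs both live in `q + 1 ≤ n`; first open case `(n, p) = (4, 2)`. [folklore] -/
theorem crux_of_lt (hX : IsSmoothProjective n X) {q : ℕ} (hq : n < q + 1)
    (c : complexBetti X (2 * (q + 1))) (hc : IsRationalClass c)
    (hs : ∃ A : HodgeModel n X, A.IsSymbolNormalized q ∧ A.HasSymbolCocycle q c) :
    c ∈ algebraicClasses X (q + 1) := by
  have _ := hX; have _ := hc
  obtain ⟨A, -, hS⟩ := hs
  rw [eq_zero_of_hasSymbolCocycle_of_lt A hq hS]
  exact Submodule.zero_mem _

/-! ### §3 Load-bearing hypothesis (a): the integer multiple must be NON-ZERO -/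

/-- `A.HasSymbolCocycle q c` with the clause `m ≠ 0` DELETED. [folklore] -/
def HasSymbolCocycleAnyMultiple (A : HodgeModel n X) (q : ℕ) (c : complexBetti X (2 * (q + 1))) :
    Prop :=
  ∃ (ι : Type) (_ : Fintype ι) (U : ι → Set A.carrier) (hU : ∀ i, IsOpen (U i))
    (_ : ∀ x, ∃ i, x ∈ U i) (σ : (Fin (q + 2) → ι) → ((Fin (q + 1) → (A.carrier → ℂ)) →₀ ℤ))
    (_ : IsMilnorSymbolCocycle A.model U σ)
    (θ : cclosedSmoothForms A.model A.carrier (2 * q + 1 + 1)) (m : ℤ),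
    IsTransgression hU q (fun J ↦ symbolForm A.model (q + 1) (σ J)) θ ∧
      A.deRham A.carrier (2 * q + 1 + 1)
          (complexDeRhamCohomology.mk A.model A.carrier (2 * q + 1 + 1) θ) =
        (m : ℂ) • A.pullback (2 * q + 1 + 1) c

/-- **Without `m ≠ 0` EVERY class has a symbol cocycle**: one-set cover, `σ = 0`, the zero zig-zag,
`θ = 0`, `m = 0` (`A.deRham [0] = 0 = 0 • A^* c`). [folklore] -/
theorem hasSymbolCocycleAnyMultiple (A : HodgeModel n X) (q : ℕ) (c : complexBetti X (2 * (q + 1))) :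
    HasSymbolCocycleAnyMultiple A q c := by
  refine ⟨Unit, inferInstance, fun _ ↦ Set.univ, fun _ ↦ isOpen_univ, fun x ↦ ⟨(), Set.mem_univ x⟩,
    0, isMilnorSymbolCocycle_zero _, 0, 0, ?_, ?_⟩
  · refine ⟨fun _ _ ↦ 0, fun J x _ ↦ ?_, fun a b _ _ ↦ ?_, fun J x _ ↦ ?_⟩
    · simp only [map_zero, Pi.zero_apply, symbolForm_zero, ZeroMemClass.coe_zero]
    · simp only [map_zero]
    · simp only [map_zero, Pi.zero_apply, ZeroMemClass.coe_zero]
  · simp only [map_zero, Int.cast_zero, zero_smul]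

/-- The crux with `m ≠ 0` deleted from the symbol-cocycle clause. [folklore] -/
def GKWithoutNonzero : Prop :=
  ∀ ⦃n : ℕ⦄ ⦃X : SchemeOver ℂ⦄, IsSmoothProjective n X →
    ∀ (q : ℕ) (c : complexBetti X (2 * (q + 1))), IsRationalClass c →
      (∃ A : HodgeModel n X, A.IsSymbolNormalized q ∧ HasSymbolCocycleAnyMultiple A q c) →
        c ∈ algebraicClasses X (q + 1)

/-- "Every rational class of a symbol-normalisable degree is algebraic" — the blatantly false
statement (`H²` of an abelian surface has `b₂ = 6 > 4 ≥ ρ`: rational classes outside `NS_ℚ`, which are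
not algebraic since algebraic classes are of type `(1,1)`) to which the crux COLLAPSES when a
load-bearing clause is removed (§3, §4). The tree cannot yet exhibit the witness on its own carriers
(it needs a normalised model and the Hodge decomposition of one concrete surface), so it enters the
`_false_of` lemmas as a hypothesis `¬ RationalClassesAlgebraic`.
[cite: VoisinHodgeI2002, §7.1.1 and §11.3] -/
def RationalClassesAlgebraic : Prop :=
  ∀ ⦃n : ℕ⦄ ⦃X : SchemeOver ℂ⦄, IsSmoothProjective n X →
    ∀ (q : ℕ), (∃ A : HodgeModel n X, A.IsSymbolNormalized q) →
      ∀ (c : complexBetti X (2 * (q + 1))), IsRationalClass c → c ∈ algebraicClasses X (q + 1)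

/-- **Without `m ≠ 0` the crux IS "all rational classes are algebraic"** (in normalisable degrees).
[folklore] -/
theorem gkWithoutNonzero_iff : GKWithoutNonzero ↔ RationalClassesAlgebraic :=
  ⟨fun h _ _ hX q ⟨A, hN⟩ c hc ↦ h hX q c hc ⟨A, hN, hasSymbolCocycleAnyMultiple A q c⟩,
    fun h _ _ hX q c hc ⟨A, hN, _⟩ ↦ h hX q ⟨A, hN⟩ c hc⟩

/-- **`m ≠ 0` is load-bearing**: any proof of the crux must use it, since without it the statement is
false as soon as one smooth projective variety carries, in a symbol-normalisable degree, a rational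
non-algebraic class (abelian / K3 surfaces, degree 2). [cite: VoisinHodgeI2002, §11.3] -/
theorem gkWithoutNonzero_false_of (h : ¬ RationalClassesAlgebraic) : ¬ GKWithoutNonzero :=
  fun h' ↦ h (gkWithoutNonzero_iff.1 h')

/-! ### §4 Load-bearing hypothesis (a): the open sets must COVER `X^an` -/

/-- `A.HasSymbolCocycle q c` with the covering clause `∀ x, ∃ i, x ∈ U i` DELETED. [folklore] -/
def HasSymbolCocycleNoCover (A : HodgeModel n X) (q : ℕ) (c : complexBetti X (2 * (q + 1))) : Prop :=
  ∃ (ι : Type) (_ : Fintype ι) (U : ι → Set A.carrier) (hU : ∀ i, IsOpen (U i))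
    (σ : (Fin (q + 2) → ι) → ((Fin (q + 1) → (A.carrier → ℂ)) →₀ ℤ))
    (_ : IsMilnorSymbolCocycle A.model U σ)
    (θ : cclosedSmoothForms A.model A.carrier (2 * q + 1 + 1)) (m : ℤ),
    m ≠ 0 ∧ IsTransgression hU q (fun J ↦ symbolForm A.model (q + 1) (σ J)) θ ∧
      A.deRham A.carrier (2 * q + 1 + 1)
          (complexDeRhamCohomology.mk A.model A.carrier (2 * q + 1 + 1) θ) =
        (m : ℂ) • A.pullback (2 * q + 1 + 1) c

/-- **Without the covering clause EVERY class has a symbol cocycle with `m = 1`**: take the EMPTY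
cover (index type `Empty`, which is finite); all cochain types `Π (J : Fin (a+1) → Empty), …` are
singletons, so every condition of `IsMilnorSymbolCocycle` and of the zig-zag is vacuous, and `θ` may be
ANY closed form — choose one representing `A.deRham⁻¹ (A^* c)` (`mk_surjective`). [folklore] -/
theorem hasSymbolCocycleNoCover (A : HodgeModel n X) (q : ℕ) (c : complexBetti X (2 * (q + 1))) :
    HasSymbolCocycleNoCover A q c := by
  obtain ⟨θ, hθ⟩ := complexDeRhamCohomology.mk_surjective (E := A.model) (M := A.carrier)
    (k := 2 * q + 1 + 1) ((A.deRham A.carrier (2 * q + 1 + 1)).symm (A.pullback (2 * q + 1 + 1) c))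
  refine ⟨Empty, inferInstance, fun i ↦ i.elim, fun i ↦ i.elim, fun J ↦ (J 0).elim,
    ⟨fun J ↦ (J 0).elim, fun J' ↦ (J' 0).elim⟩, θ, 1, one_ne_zero, ?_, ?_⟩
  · exact ⟨fun a b J ↦ (J 0).elim, fun J ↦ (J 0).elim, fun a b _ _ ↦ funext fun J ↦ (J 0).elim,
      fun J ↦ (J 0).elim⟩
  · rw [hθ, LinearEquiv.apply_symm_apply, Int.cast_one, one_smul]

/-- The crux with the covering clause deleted from the symbol-cocycle clause. [folklore] -/
def GKWithoutCover : Prop :=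
  ∀ ⦃n : ℕ⦄ ⦃X : SchemeOver ℂ⦄, IsSmoothProjective n X →
    ∀ (q : ℕ) (c : complexBetti X (2 * (q + 1))), IsRationalClass c →
      (∃ A : HodgeModel n X, A.IsSymbolNormalized q ∧ HasSymbolCocycleNoCover A q c) →
        c ∈ algebraicClasses X (q + 1)

/-- **Without the covering clause the crux IS "all rational classes are algebraic"**. [folklore] -/
theorem gkWithoutCover_iff : GKWithoutCover ↔ RationalClassesAlgebraic :=
  ⟨fun h _ _ hX q ⟨A, hN⟩ c hc ↦ h hX q c hc ⟨A, hN, hasSymbolCocycleNoCover A q c⟩,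
    fun h _ _ hX q c hc ⟨A, hN, _⟩ ↦ h hX q ⟨A, hN⟩ c hc⟩

/-- **The covering clause is load-bearing** (it is the only clause through which `θ`, and hence `c`,
sees the symbol data): without it the crux is false modulo the same transcendental witness.
[cite: BottTu1982Forms, §8 Prop. 8.8] -/
theorem gkWithoutCover_false_of (h : ¬ RationalClassesAlgebraic) : ¬ GKWithoutCover :=
  fun h' ↦ h (gkWithoutCover_iff.1 h')

/-! ### §5 Hypotheses that are NOT load-bearing for the truth value -/

/-- The crux with the normalisation clause deleted (census S⁺₁). [folklore] -/
def GKWithoutNorm : Prop :=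
  ∀ ⦃n : ℕ⦄ ⦃X : SchemeOver ℂ⦄, IsSmoothProjective n X →
    ∀ (q : ℕ) (c : complexBetti X (2 * (q + 1))), IsRationalClass c →
      (∃ A : HodgeModel n X, A.HasSymbolCocycle q c) → c ∈ algebraicClasses X (q + 1)

/-- **Dropping normalisation only STRENGTHENS the crux** (trivial direction; the converse — the free
scalar of `A.deRham` is invisible because `algebraicClasses` is a `ℂ`-subspace and all models are
isomorphic analytifications — needs `IsAnalytification.unique` + scalar rigidity of natural
comparisons, not available here). So NORM cannot be shown load-bearing, and indeed is not. [folklore] -/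
theorem crux_of_gkWithoutNorm (h : GKWithoutNorm) : SymbolClassesAlgebraic :=
  crux_iff_gk.2 fun _ _ hX q c hc ⟨A, _, hS⟩ ↦ h hX q c hc ⟨A, hS⟩

/-- `A.HasSymbolCocycle q c` with `Fintype ι` DELETED (arbitrary covers). [folklore] -/
def HasSymbolCocycleAnyCover (A : HodgeModel n X) (q : ℕ) (c : complexBetti X (2 * (q + 1))) : Prop :=
  ∃ (ι : Type) (U : ι → Set A.carrier) (hU : ∀ i, IsOpen (U i))
    (_ : ∀ x, ∃ i, x ∈ U i) (σ : (Fin (q + 2) → ι) → ((Fin (q + 1) → (A.carrier → ℂ)) →₀ ℤ))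
    (_ : IsMilnorSymbolCocycle A.model U σ)
    (θ : cclosedSmoothForms A.model A.carrier (2 * q + 1 + 1)) (m : ℤ),
    m ≠ 0 ∧ IsTransgression hU q (fun J ↦ symbolForm A.model (q + 1) (σ J)) θ ∧
      A.deRham A.carrier (2 * q + 1 + 1)
          (complexDeRhamCohomology.mk A.model A.carrier (2 * q + 1 + 1) θ) =
        (m : ℂ) • A.pullback (2 * q + 1 + 1) c

/-- The crux over arbitrary (not necessarily finite) covers. [folklore] -/
def GKWithoutFintype : Prop :=
  ∀ ⦃n : ℕ⦄ ⦃X : SchemeOver ℂ⦄, IsSmoothProjective n X →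
    ∀ (q : ℕ) (c : complexBetti X (2 * (q + 1))), IsRationalClass c →
      (∃ A : HodgeModel n X, A.IsSymbolNormalized q ∧ HasSymbolCocycleAnyCover A q c) →
        c ∈ algebraicClasses X (q + 1)

/-- **Dropping `Fintype ι` only STRENGTHENS the crux** (trivial direction). Mathematically the converse
also holds (`X^an` is compact: refine to a finite subcover and restrict the cochains), so finiteness of
the cover is a convenience, not a resource. [folklore] -/
theorem crux_of_gkWithoutFintype (h : GKWithoutFintype) : SymbolClassesAlgebraic :=
  crux_iff_gk.2 fun _ _ hX q c hc ⟨A, hN, ι, _, U, hU, hcov, σ, hσ, θ, m, hm, hT, hdR⟩ ↦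
    h hX q c hc ⟨A, hN, ι, U, hU, hcov, σ, hσ, θ, m, hm, hT, hdR⟩

/-- **`IsRationalClass c` is invisible to the conclusion**: `algebraicClasses X p` is a `ℂ`-subspace,
so the crux already makes every COMPLEX multiple of a rational symbol class algebraic, although such a
multiple is in general neither rational nor (for want of an integral symbol cocycle) a symbol class.
What rationality buys is only bookkeeping: symbol classes on a normalised model are expected to be
rational automatically (`(2πi)^{-p}`-periods of `dlog` forms; Deligne–Beilinson), which the tree cannot
yet prove. [folklore] -/
theorem smul_mem_algebraicClasses_of_crux (h : SymbolClassesAlgebraic) (hX : IsSmoothProjective n X)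
    {q : ℕ} {c : complexBetti X (2 * (q + 1))} (hc : IsRationalClass c)
    (hs : ∃ A : HodgeModel n X, A.IsSymbolNormalized q ∧ A.HasSymbolCocycle q c) (z : ℂ) :
    z • c ∈ algebraicClasses X (q + 1) :=
  Submodule.smul_mem _ z (crux_iff_gk.1 h hX q c hc hs)

/-! ### §6 Anti-vacuity in weight one, modulo normalisation -/

/-- **A normalisation witness in degree 2 is itself a non-zero rational symbol class**: the transition
cocycle `(g_ij)` of the normalising line bundle IS a Milnor symbol `1`-cocycle of weight `1`
(`isMilnorSymbolCocycle_symbolCochain_zero`: `g_ij g_jk = g_ik` is multilinearity + the presheaf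
identification), its symbol forms are the normalising `dlog g_ij`, and `A.deRham [θ₀] = 1 • A^* c₀`
with `c₀ ≠ 0` rational. So on a normalised model the weight-1 crux is about a non-zero class (there it
is Lefschetz (1,1) + GAGA). For `q ≥ 1` the analogue needs the cocycle property of the cup powers
`L.symbolCochain q`, not in the tree. [cite: VoisinHodgeI2002, Thm. 4.49 and Thm. 7.10 (proof)] -/
theorem exists_ne_zero_hasSymbolCocycle_of_isSymbolNormalized_zero (A : HodgeModel n X)
    (hN : A.IsSymbolNormalized 0) :
    ∃ c₀ : complexBetti X (2 * (0 + 1)), IsRationalClass c₀ ∧ c₀ ≠ 0 ∧ A.HasSymbolCocycle 0 c₀ := by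
  obtain ⟨ι, hι, L, θ₀, c₀, hT, hc₀, hne, hdR⟩ := hN
  refine ⟨c₀, hc₀, hne, ι, hι, L.baseSet, L.isOpen_baseSet, L.exists_mem_baseSet, L.symbolCochain 0,
    L.isMilnorSymbolCocycle_symbolCochain_zero, θ₀, 1, one_ne_zero, hT, ?_⟩
  rw [hdR, Int.cast_one, one_smul]

/-! ### §7 Near-misses and refuted strengthenings (prose; nothing here is used above)

* KÄHLER GK (census S⁺₃) is false: on Zucker's and Voisin's tori the Weil classes are symbol classes
  (2001 Appell–Humbert computation, route header) while no analytic cycle / coherent sheaf carries them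
  (`Literature.Barriers.HodgeConjecture.Zucker1977_kaehlerTorus_noAnalyticCycles`,
  `Literature.Barriers.HodgeConjecture.Voisin2002_weilTorus_hodgeClassWithoutSubvarieties`). Inside THIS
  signature projectivity cannot be dropped to reach them: `X` is a `SchemeOver ℂ` and `HodgeModel n X`
  demands the Hodge decomposition on `X^an`; a smooth proper scheme with Kähler analytification is
  projective (Moishezon), and non-proper schemes essentially never carry a Hodge model with interesting
  even cohomology. So `IsSmoothProjective` is load-bearing mathematically but not demonstrably so here.
* INTEGRAL GK (`m = 1`, census S⁺₅) is false on Kollár's very general hypersurface threefolds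
  (`Literature.Barriers.HodgeConjecture.Kollar1992_nonTorsionClass_notAlgebraic`; 2001 Thm 7.4), so the
  saturation `∃ m ≠ 0` is tight: it can be neither removed (§3) nor set to `1`.
* HOLOMORPHY OF THE UNITS: with `IsGoodTuple` dropped, weight-1 "symbol classes" are the Chern classes
  of all SMOOTH complex line bundles, i.e. all of `H²(X, ℤ)`, and the weakened crux is again
  `RationalClassesAlgebraic`; the smooth Čech–de Rham datum (partition-of-unity connection forms) is not
  constructible on the abstract carrier of a Hodge model in this tree, so no `_false_without_` theorem is
  recorded — near-miss, no `sorry` kept.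
* THE `milnorRel`-COCYCLE CLAUSE is implied at the level of forms by the zig-zag (`w = δ Z_{q,q+1}` on
  `U_J` forces `δ w = 0` on `U_{J'}`), so it restricts the CLASS only through K-theory: dropping it
  enlarges the symbol classes at most to the image of `Ȟ^p(𝔘, dlog-forms)`, still inside `F^p`, still
  below HC — not refutable, and a prover gets no de Rham information from it.
* NORMALISATION pins the free scalar of `A.deRham` in degree `2p` into `ℚˣ · (2πi)^{-p}` (given
  `c₁(L)^p ≠ 0`); since `algebraicClasses` is a `ℂ`-subspace this is invisible to the truth value
  (§5), but it is what makes `Alg ⊆ L` (support stmt-18703) and `h^p ∈ L` statable.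
* WHY NO COUNTEREXAMPLE SEARCH CAN CLOSE: by §1 a rational non-algebraic symbol class on a projective
  fourfold (`S × S'`, CY, HK — the crux's own "why it might fail") would be a counterexample to the
  Hodge conjecture; exhibiting even one exotic holomorphic Milnor 2-cocycle on a projective fourfold
  needs a LIFT-type construction (known only on tori), and certifying non-algebraicity is HC-hard.
-/

/-! ### §8 De-Rham-invisible symbol cocycles carry only the zero class (weight one, checked)

Census loophole (iv) made precise in weight `1`: the `K`-theoretic part of a symbol cocycle that
`dlog` does not see (e.g. symbols of CONSTANT units, `dlog a = 0`) contributes nothing — if all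
symbol forms vanish on the `U_J`, any transgression is exact and `c = 0`. The general-weight version
is the injectivity half of the Čech–de Rham theorem (rows exact by partitions of unity, Bott–Tu
Prop. 8.5/8.8); only the column-`0` gluing needed for `q = 0` is done here. -/

section Forms

variable {E : Type*} [NormedAddCommGroup E] [NormedSpace ℝ E]
  {H : Type*} [TopologicalSpace H] {I : ModelWithCorners ℝ E H}
  {M : Type*} [TopologicalSpace M] [ChartedSpace H M] [IsManifold I ∞ M]
  {F : Type*} [NormedAddCommGroup F] [NormedSpace ℝ F]
  {ι : Type*} {U : ι → Set M} {hU : ∀ i, IsOpen (U i)}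

/-- **Weight one: a transgression of the ZERO cochain over a cover is exact.** If `δ Z_{0,1} = 0`
on every `U_i ∩ U_j` then the `Z_{0,1,(i)}` glue (`apply_eq_apply_of_cechδ_eq_zero`) to a global
smooth form `η` with `dη = θ`. [cite: BottTu1982Forms, §8 Prop. 8.5] -/
theorem exists_mextDeriv_eq_of_isTransgression_zero_zero {θ : MForm I M F (2 * 0 + 1 + 1)}
    (h : IsTransgression hU 0 (0 : (Fin (0 + 2) → ι) → MForm I M F (0 + 1)) θ)
    (hcov : ∀ x, ∃ i, x ∈ U i) :
    ∃ η : MForm I M F (2 * 0 + 1), IsSmoothForm η ∧ mextDeriv η = θ := by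
  obtain ⟨Z, ht, -, hb⟩ := h
  set c : CechForms I F U 0 (2 * 0 + 1) := Z 0 (2 * 0 + 1) with hc
  -- `δ c = 0` as a cochain: on `U_J` by the top equation, off `U_J` because cochains vanish there
  have hδ : cechδ I F hU 0 (2 * 0 + 1) c = 0 := by
    funext J
    refine Subtype.ext (funext fun x ↦ ?_)
    by_cases hx : x ∈ cechSet U J
    · exact ht J x hx
    · exact ((cechδ I F hU 0 (2 * 0 + 1) c J).2.2 x hx).trans rfl
  -- glue the components along a choice of index at each point
  choose i hi using hcov
  let η : MForm I M F (2 * 0 + 1) := fun x ↦ (c (fun _ ↦ i x) : MForm I M F (2 * 0 + 1)) x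
  have hη : ∀ x, ∀ᶠ y in 𝓝 x, η y = (c (fun _ ↦ i x) : MForm I M F (2 * 0 + 1)) y := fun x ↦ by
    filter_upwards [(hU (i x)).mem_nhds (hi x)] with y hy
    have hyJ : y ∈ cechSet U (fun _ : Fin 1 ↦ i x) := by
      rw [cechSet_fin_one]; exact hy
    exact apply_eq_apply_of_cechδ_eq_zero hU hδ (fun _ ↦ i x) (i y) (hi y) hyJ
  refine ⟨η, fun x ↦ ?_, funext fun x ↦ ?_⟩
  · have hxJ : x ∈ cechSet U (fun _ : Fin 1 ↦ i x) := by rw [cechSet_fin_one]; exact hi x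
    exact (MForm.smoothAt_congr_of_eventuallyEq (hη x)).2
      ((c (fun _ ↦ i x)).2.1 x hxJ)
  · have hxJ : x ∈ cechSet U (fun _ : Fin 1 ↦ i x) := by rw [cechSet_fin_one]; exact hi x
    rw [mextDeriv_congr_of_eventuallyEq (hη x), ← hb _ x hxJ, cechd_apply, pow_zero, one_smul,
      localD_apply_of_mem _ _ hxJ]

end Forms

/-- **De-Rham-invisible weight-one symbol cocycles carry only the zero class.** If a class `c` is
carried (`m ≠ 0`, `A.deRham [θ] = m • A^* c`) by a weight-1 symbol cocycle `σ` whose symbol forms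
`Σ n · dlog f` VANISH on every `U_J` (e.g. `σ` supported on constant units — the `K`-theoretic
content invisible to `dlog`), then `θ` transgresses the zero cochain, hence is exact
(`exists_mextDeriv_eq_of_isTransgression_zero_zero`), `[θ] = 0` and `c = 0`. So the kernel of
`dlog` on `𝒦^M_1` contributes nothing to symbol classes beyond `0`: no counterexample can hide in
the de-Rham-invisible part of a cocycle. [cite: BottTu1982Forms, §8 Prop. 8.8] -/
theorem eq_zero_of_invisible_symbolCocycle_one (A : HodgeModel n X)
    {c : complexBetti X (2 * (0 + 1))}
    {ι : Type} {U : ι → Set A.carrier} (hU : ∀ i, IsOpen (U i)) (hcov : ∀ x, ∃ i, x ∈ U i)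
    (σ : (Fin (0 + 2) → ι) → ((Fin (0 + 1) → (A.carrier → ℂ)) →₀ ℤ))
    (hσ : ∀ J, ∀ x ∈ cechSet U J, symbolForm A.model (0 + 1) (σ J) x = 0)
    (θ : cclosedSmoothForms A.model A.carrier (2 * 0 + 1 + 1)) {m : ℤ} (hm : m ≠ 0)
    (hT : IsTransgression hU 0 (fun J ↦ symbolForm A.model (0 + 1) (σ J)) θ)
    (hdR : A.deRham A.carrier (2 * 0 + 1 + 1)
        (complexDeRhamCohomology.mk A.model A.carrier (2 * 0 + 1 + 1) θ) =
      (m : ℂ) • A.pullback (2 * 0 + 1 + 1) c) :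
    c = 0 := by
  -- the same zig-zag transgresses the zero cochain
  have hT0 : IsTransgression hU 0 (0 : (Fin (0 + 2) → ι) → MForm 𝓘(ℝ, A.model) A.carrier ℂ (0 + 1))
      (θ : MForm 𝓘(ℝ, A.model) A.carrier ℂ (2 * 0 + 1 + 1)) := by
    obtain ⟨Z, ht, hs, hb⟩ := hT
    exact ⟨Z, fun J x hx ↦ (ht J x hx).trans (hσ J x hx), hs, hb⟩
  obtain ⟨η, hη, hdη⟩ := exists_mextDeriv_eq_of_isTransgression_zero_zero hT0 hcov
  -- so `θ` is exact and its class vanishes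
  have hθ : (θ : MForm 𝓘(ℝ, A.model) A.carrier ℂ (2 * 0 + 1 + 1)) ∈
      cexactSmoothForms A.model A.carrier (2 * 0 + 1 + 1) :=
    Submodule.subset_span ⟨η, (mem_csmoothForms_iff η).2 hη, hdη⟩
  have hmk : complexDeRhamCohomology.mk A.model A.carrier (2 * 0 + 1 + 1) θ = 0 :=
    (Submodule.Quotient.mk_eq_zero _).2 hθ
  rw [hmk, map_zero, eq_comm, smul_eq_zero] at hdR
  rcases hdR with hm0 | h0
  · exact absurd (Int.cast_eq_zero.1 hm0) hm
  · exact A.pullback_injective (2 * 0 + 1 + 1) (by rw [h0, map_zero])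

/-! ### §9 Line `NashDescentSketch`: necessity, ceilings, degenerate cases (gen 2; `Negative/LineCeiling`) -/

section Line

open Summit.HodgeConjecture.HodgeConjecture.Theorems.MilnorKExponentialNash
  (IsNashSymbolClass AlgebraicClassesAreNashSymbolClasses)
open Summit.HodgeConjecture.HodgeConjecture.Theorems.SymbolClassesAlgebraic.Negative

/-- **(W_alg-band) is a consequence of the crux** (Nash symbol ⇒ symbol): a counterexample to the
weight stub `stub_nashHighBandAlgebraic` refutes the crux itself. Mutation: `2 ≤ q`, `q + 3 ≤ n` only
cut away proved slices (`gkNamed_outside_band`); `IsRationalClass` is invisible to the `ℂ`-subspace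
conclusion; dropping Nash-ness gives GK in the band verbatim. [folklore] -/
theorem line_not_crux_of_not_highBand
    (h : ¬ ∀ ⦃n : ℕ⦄ ⦃X : SchemeOver ℂ⦄, IsSmoothProjective n X → ∀ (q : ℕ), 2 ≤ q → q + 3 ≤ n →
      ∀ (c : complexBetti X (2 * (q + 1))), IsRationalClass c → IsNashSymbolClass n X q c →
        c ∈ algebraicClasses X (q + 1)) :
    ¬ SymbolClassesAlgebraic :=
  LineCeiling.not_symbolClassesAlgebraic_of_not_nashHighBand h

/-- **(W₁-band) is a consequence of the crux** (`N² ⊆ N¹`, and a class of `N¹` dies off ONE proper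
closed subset): a counterexample to `stub_nashWeightTwoBandDiesOffClosed` refutes the crux. Mutation:
`4 ≤ n` not load-bearing (`n ≤ 3` is the landed HC-for-threefolds slice), `IsRationalClass` invisible,
Nash-ness dropped = coniveau one for weight-2 symbol classes = GK₂ on `n`-folds (2001 Thm C; crux
strength). [cite: GrothendieckTopology1969, §1] -/
theorem line_not_crux_of_not_weightTwoBand
    (h : ¬ ∀ ⦃n : ℕ⦄ ⦃X : SchemeOver ℂ⦄, IsSmoothProjective n X → 4 ≤ n →
      ∀ (c : complexBetti X (2 * (1 + 1))), IsRationalClass c → IsNashSymbolClass n X 1 c →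
        ∃ Z : Set X.left, IsClosed Z ∧ Z ≠ Set.univ ∧
          complexBetti.restrictCompl X Z (2 * (1 + 1)) c = 0) :
    ¬ SymbolClassesAlgebraic :=
  LineCeiling.not_symbolClassesAlgebraic_of_not_nashWeightTwoBand h

/-- **(A-band) is a consequence of the crux GIVEN the Nash typing `Alg ⊆ L_Nash`**: a counterexample
to `stub_nashDescentBand` refutes `SymbolClassesAlgebraic ∨̸`… precisely: refutes the crux OR the typing
item `AlgebraicClassesAreNashSymbolClasses` — the latter is the line's one cheap falsifier (untested:
`IsNashUnitOn` has no API). Mutation: dropping `IsSymbolClass` gives "every rational class is a Nash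
symbol class", FALSE by §11 (a Nash symbol class is a symbol class, of type `(p,p)` by the landed typing
stub, and `E_i³` has a rational non-`(1,1)` class — in degree 2, outside the band, so recorded as prose). [folklore] -/
theorem line_not_crux_of_not_descentBand (hAlg : AlgebraicClassesAreNashSymbolClasses)
    (h : ¬ ∀ ⦃n : ℕ⦄ ⦃X : SchemeOver ℂ⦄, IsSmoothProjective n X → ∀ (q : ℕ), 1 ≤ q → q + 3 ≤ n →
      ∀ (c : complexBetti X (2 * (q + 1))), IsRationalClass c → IsSymbolClass n X q c →
        IsNashSymbolClass n X q c) :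
    ¬ SymbolClassesAlgebraic :=
  LineCeiling.not_symbolClassesAlgebraic_of_not_nashDescentBand hAlg h

/-- **Every stub of the line is below the Hodge conjecture** — (W_alg-band). [cite: Deligne2000, §1] -/
theorem line_not_hodgeConjecture_of_not_highBand
    (h : ¬ ∀ ⦃n : ℕ⦄ ⦃X : SchemeOver ℂ⦄, IsSmoothProjective n X → ∀ (q : ℕ), 2 ≤ q → q + 3 ≤ n →
      ∀ (c : complexBetti X (2 * (q + 1))), IsRationalClass c → IsNashSymbolClass n X q c →
        c ∈ algebraicClasses X (q + 1)) :
    ¬ _root_.HodgeConjecture :=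
  LineCeiling.not_hodgeConjecture_of_not_nashHighBand h

/-- **Every stub of the line is below the Hodge conjecture** — (W₁-band). [cite: Deligne2000, §1] -/
theorem line_not_hodgeConjecture_of_not_weightTwoBand
    (h : ¬ ∀ ⦃n : ℕ⦄ ⦃X : SchemeOver ℂ⦄, IsSmoothProjective n X → 4 ≤ n →
      ∀ (c : complexBetti X (2 * (1 + 1))), IsRationalClass c → IsNashSymbolClass n X 1 c →
        ∃ Z : Set X.left, IsClosed Z ∧ Z ≠ Set.univ ∧
          complexBetti.restrictCompl X Z (2 * (1 + 1)) c = 0) :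
    ¬ _root_.HodgeConjecture :=
  LineCeiling.not_hodgeConjecture_of_not_nashWeightTwoBand h

/-- **Every stub of the line is below the Hodge conjecture** — (A-band), modulo `Alg ⊆ L_Nash`.
[cite: Deligne2000, §1] -/
theorem line_not_hodgeConjecture_and_algNash_of_not_descentBand
    (h : ¬ ∀ ⦃n : ℕ⦄ ⦃X : SchemeOver ℂ⦄, IsSmoothProjective n X → ∀ (q : ℕ), 1 ≤ q → q + 3 ≤ n →
      ∀ (c : complexBetti X (2 * (q + 1))), IsRationalClass c → IsSymbolClass n X q c →
        IsNashSymbolClass n X q c) :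
    ¬ (_root_.HodgeConjecture ∧ AlgebraicClassesAreNashSymbolClasses) :=
  LineCeiling.not_hodgeConjecture_and_algNash_of_not_nashDescentBand h

/-- **Degenerate case checked**: a smooth projective variety is non-empty (the empty scheme — smooth
of every relative dimension, a closed subscheme of `ℙᴺ` — is excluded by `GeometricallyIrreducible`), so
the clause `Z ≠ Set.univ` of (W₁-band) is consistent … [cite: StacksProject, Tag 0366] -/
theorem line_nonempty (hX : IsSmoothProjective n X) : Nonempty X.left :=
  LineCeiling.nonempty_of_isSmoothProjective hX

/-- … and holds for the zero class (dies off `∅ ≠ univ`). [folklore] -/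
theorem line_dieOffClosed_zero (hX : IsSmoothProjective n X) (i : ℕ) :
    ∃ Z : Set X.left, IsClosed Z ∧ Z ≠ Set.univ ∧
      complexBetti.restrictCompl X Z i (0 : complexBetti X i) = 0 :=
  LineCeiling.dieOffClosed_zero hX i

end Line

/-! ### §10 Anti-vacuity in the whole band (gen 2; `Negative/BandAntiVacuity`) -/

section Band

open Summit.HodgeConjecture.HodgeConjecture.Theorems.SymbolClassesAlgebraic.Negative

/-- **The cup powers of a transition cocycle are Milnor symbol cocycles in EVERY weight** (gen 1's
§6 had `q = 0`): `L.symbolCochain (q+1)` is the Čech cup product of `L.symbolCochain q` with the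
transition cocycle, and cup products of Milnor cocycles are Milnor cocycles
(`SymbolLiftR.CupStep.isMilnorSymbolCocycle_cupChain`). [cite: BottTu1982Forms, §8 (8.4)] -/
theorem band_isMilnorSymbolCocycle_symbolCochain {M : Type*} {E : Type*} [NormedAddCommGroup E]
    [NormedSpace ℂ E] [TopologicalSpace M] [ChartedSpace E M] {ι : Type*}
    (L : HolomorphicLineBundle ι E M) (q : ℕ) : IsMilnorSymbolCocycle E L.baseSet (L.symbolCochain q) :=
  BandAntiVacuity.isMilnorSymbolCocycle_symbolCochain L q

/-- **GK is nowhere vacuous in its band**: for every `q + 1 ≤ n` a NON-ZERO RATIONAL symbol class of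
weight `q + 1` exists on every smooth projective `n`-fold (normalised models exist,
`SymbolLiftR.normalisedModelsExist`; the normalisation witness is itself a symbol cocycle).
[cite: VoisinHodgeI2002, Thm. 7.10 (proof) and Cor. 3.9] -/
theorem band_exists_ne_zero_isSymbolClass (hX : IsSmoothProjective n X) (q : ℕ) (hq : q + 1 ≤ n) :
    ∃ c : complexBetti X (2 * (q + 1)), IsRationalClass c ∧ c ≠ 0 ∧ IsSymbolClass n X q c :=
  BandAntiVacuity.exists_ne_zero_isSymbolClass hX q hq

/-- The same in the route's inlined shape `∃ A, A.IsSymbolNormalized q ∧ A.HasSymbolCocycle q c`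
(`crux_iff_gk`): the hypothesis of `SymbolClassesAlgebraic` has non-zero rational instances in every
weight of the band, first open one `(n, p) = (4, 2)`. [cite: VoisinHodgeI2002, Thm. 7.10 (proof)] -/
theorem band_exists_ne_zero_routeHypothesis (hX : IsSmoothProjective n X) (q : ℕ) (hq : q + 1 ≤ n) :
    ∃ c : complexBetti X (2 * (q + 1)), IsRationalClass c ∧ c ≠ 0 ∧
      ∃ A : HodgeModel n X, A.IsSymbolNormalized q ∧ A.HasSymbolCocycle q c :=
  BandAntiVacuity.exists_ne_zero_routeHypothesis hX q hq

end Band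

/-! ### §11 The transcendental witness; §3 and §4 made unconditional (gen 2; `Negative/TranscendentalWitness`) -/

section Witness

open Summit.HodgeConjecture.HodgeConjecture.Theorems.SymbolClassesAlgebraic.Negative

/-- **A smooth projective complex threefold with a RATIONAL class of `H²` NOT of Hodge type
`(1,1)`** (`E_i³ = cubeScheme i`; the witness every Hodge disprover's `_false_of` lemma was waiting
for). [cite: LangeBirkenhake1992, §1.1.5 Prop. 1.1.23] [cite: VoisinHodgeI2002, §7.1.1 and §11.3.1] -/
theorem witness_exists_isRationalClass_not_isOfHodgeType :
    ∃ (X : SchemeOver ℂ) (c : complexBetti X 2),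
      IsSmoothProjective 3 X ∧ IsRationalClass c ∧ ¬ IsOfHodgeType 3 X 2 1 1 c :=
  TranscendentalWitness.exists_isRationalClass_not_isOfHodgeType

/-- **… hence a rational NON-ALGEBRAIC class in `H²` of a smooth projective variety** (algebraic
classes are of type `(p,p)`). [cite: VoisinHodgeI2002, §11.1.2 Prop. 11.20 and §11.3.1] -/
theorem witness_exists_isRationalClass_not_mem_algebraicClasses :
    ∃ (X : SchemeOver ℂ) (c : complexBetti X (2 * 1)),
      IsSmoothProjective 3 X ∧ IsRationalClass c ∧ c ∉ algebraicClasses X 1 :=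
  TranscendentalWitness.exists_isRationalClass_not_mem_algebraicClasses

/-- **`RationalClassesAlgebraic` (§3) is FALSE**: `E_i³`, `q = 0`, a normalised model in degree `2`
(`SymbolLiftR.normalisedModelsExist`) and the rational non-algebraic class of the witness.
[cite: VoisinHodgeI2002, §11.3.1] -/
theorem not_rationalClassesAlgebraic : ¬ RationalClassesAlgebraic := by
  obtain ⟨n, X, q, A, c, hX, hN, hc, hna⟩ := TranscendentalWitness.exists_loadBearingWitness
  exact fun h ↦ hna (h hX q ⟨A, hN⟩ c hc)

/-- **§3 UNCONDITIONAL: the crux with `m ≠ 0` deleted is FALSE.** Any proof of GK must use `m ≠ 0`.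
[cite: VoisinHodgeI2002, §11.3.1] -/
theorem not_gkWithoutNonzero : ¬ GKWithoutNonzero :=
  gkWithoutNonzero_false_of not_rationalClassesAlgebraic

/-- **§4 UNCONDITIONAL: the crux with the covering clause deleted is FALSE.** Any proof of GK must use
that the open sets cover `X^an`. [cite: BottTu1982Forms, §8 Prop. 8.8] -/
theorem not_gkWithoutCover : ¬ GKWithoutCover :=
  gkWithoutCover_false_of not_rationalClassesAlgebraic

end Witness

/-! ### §12 The Nash vocabulary passes its smoke test; what would change the verdict (gen 2)

`IsNashUnitOn` (the line's one new predicate) had NO API in the tree. Two checked seeds, so that the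
typing test of §9/(A) — `Alg ⊆ L_Nash` — can actually be run by the line's workers: the constant `1` is a
Nash unit, and so is every holomorphic unit which, near each point of `W`, is the pull-back of a regular
function on an affine open (degree-one relation `f - s = 0`; the `evalOrZero` plumbing is a pair of ring
homomorphisms, `AlgPoints.eval`). Consequently the zero class is a Nash symbol class in every weight of
the band (zero cocycle on a normalised model), so the hypotheses of (W₁)/(W_alg) are satisfiable; a
NON-ZERO Nash symbol class (`h^{q+1}` through the regular cocycle `x_j/x_i` of `𝒪(1)`) is the next test
and needs only a Hermitian metric on that algebraic presentation plus `PowerNormalisation.exists_class`. -/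

section Nash

open CategoryTheory AlgebraicGeometry
open Summit.HodgeConjecture.HodgeConjecture.Theorems.MilnorKExponentialNash
open Summit.HodgeConjecture.HodgeConjecture.Theorems.SymbolLiftR (normalisedModelsExist)

/-- **Regular pull-backs are Nash units.** A holomorphic unit `f` on `W ⊆ X^an` which near every point
of `W` agrees on `W` with `s ∘ φ` for a regular function `s` on an affine open `U ∋ φ(x)` is a Nash unit:
the relation `(-s)(φ y) · f(y)⁰ + 1(φ y) · f(y)¹ = 0`, with the coefficient `1` non-zero wherever
`φ(y) ∈ U` (an analytic neighbourhood, `IsAnalytification.isOpen_preimage`). [cite: Artin1969, Thm. 1.10 and §2] -/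
theorem nash_isNashUnitOn_of_regular (A : HodgeModel n X) {W : Set A.carrier} {f : A.carrier → ℂ}
    (hf : IsHolUnitOn A.model W f)
    (hreg : ∀ x ∈ W, ∃ (U : X.left.affineOpens) (s : Γ(X.left, (↑U : X.left.Opens))),
      (A.toComplexPoints x).pt ∈ (↑U : X.left.Opens) ∧
        ∀ᶠ y in 𝓝 x, y ∈ W → f y = AlgPoints.evalOrZero (↑U : X.left.Opens) s (A.toComplexPoints y)) :
    IsNashUnitOn A W f := by
  refine ⟨hf, fun x hx ↦ ?_⟩
  obtain ⟨U, s, hxU, hfs⟩ := hreg x hx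
  have hopen : IsOpen (A.toComplexPoints ⁻¹' {P | P.pt ∈ (↑U : X.left.Opens)}) :=
    A.isAnalytification.isOpen_preimage _
  have hev : ∀ᶠ y in 𝓝 x, (A.toComplexPoints y).pt ∈ (↑U : X.left.Opens) := hopen.mem_nhds hxU
  have h1 : ∀ y, (A.toComplexPoints y).pt ∈ (↑U : X.left.Opens) →
      AlgPoints.evalOrZero (↑U : X.left.Opens) (1 : Γ(X.left, (↑U : X.left.Opens))) (A.toComplexPoints y) = 1 := by
    intro y hy
    rw [AlgPoints.evalOrZero_of_mem _ hy, AlgPoints.eval, map_one, map_one]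
  have hneg : ∀ y, (A.toComplexPoints y).pt ∈ (↑U : X.left.Opens) →
      AlgPoints.evalOrZero (↑U : X.left.Opens) (-s) (A.toComplexPoints y) =
        -AlgPoints.evalOrZero (↑U : X.left.Opens) s (A.toComplexPoints y) := by
    intro y hy
    rw [AlgPoints.evalOrZero_of_mem _ hy, AlgPoints.evalOrZero_of_mem _ hy, AlgPoints.eval, AlgPoints.eval,
      map_neg, map_neg]
  refine ⟨U, 1, ![-s, 1], hxU, ⟨1, ?_⟩, ?_⟩
  · refine (hev.mono fun y hy ↦ ?_).frequently
    change AlgPoints.evalOrZero (↑U : X.left.Opens) (1 : Γ(X.left, (↑U : X.left.Opens))) (A.toComplexPoints y) ≠ 0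
    rw [h1 y hy]
    exact one_ne_zero
  · filter_upwards [hev, hfs] with y hy hyf hyW
    rw [Fin.sum_univ_two]
    change AlgPoints.evalOrZero (↑U : X.left.Opens) (-s) (A.toComplexPoints y) * f y ^ (0 : ℕ) +
      AlgPoints.evalOrZero (↑U : X.left.Opens) (1 : Γ(X.left, (↑U : X.left.Opens))) (A.toComplexPoints y) *
        f y ^ (1 : ℕ) = 0
    rw [h1 y hy, hneg y hy, hyf hyW]
    ring

/-- **The constant `1` is a Nash unit** on every `W` (relation `-1 + 1 · 1 = 0` over any affine open
through the point; affine opens form a basis). Smoke test of the predicate: PASSED. [cite: Artin1969, Thm. 1.10 and §2] -/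
theorem nash_isNashUnitOn_one (A : HodgeModel n X) (W : Set A.carrier) : IsNashUnitOn A W 1 := by
  refine nash_isNashUnitOn_of_regular A (isHolUnitOn_one W) fun x _ ↦ ?_
  obtain ⟨_, ⟨U, hU, rfl⟩, hxU, -⟩ :=
    X.left.isBasis_affineOpens.exists_subset_of_mem_open (Set.mem_univ (A.toComplexPoints x).pt) isOpen_univ
  have hopen : IsOpen (A.toComplexPoints ⁻¹' {P | P.pt ∈ U}) := A.isAnalytification.isOpen_preimage U
  have hev : ∀ᶠ y in 𝓝 x, (A.toComplexPoints y).pt ∈ U := hopen.mem_nhds hxU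
  refine ⟨⟨U, hU⟩, 1, hxU, hev.mono fun y hy _ ↦ ?_⟩
  change (1 : ℂ) = AlgPoints.evalOrZero U (1 : Γ(X.left, U)) (A.toComplexPoints y)
  rw [AlgPoints.evalOrZero_of_mem _ hy, AlgPoints.eval, map_one, map_one]

/-- **The zero class is a Nash symbol class in every weight of the band** (zero cocycle — no units at
all — on a symbol-normalised model, `SymbolLiftR.normalisedModelsExist`): the hypotheses of the weight
stubs (W₁)/(W_alg) are satisfiable. [folklore] -/
theorem nash_isNashSymbolClass_zero (hX : IsSmoothProjective n X) (q : ℕ) (hq : q + 1 ≤ n) :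
    IsNashSymbolClass n X q 0 := by
  obtain ⟨A, hN⟩ := normalisedModelsExist hX q hq
  refine ⟨A, fun _ ↦ hN, Unit, inferInstance, fun _ ↦ Set.univ, fun _ ↦ isOpen_univ,
    fun x ↦ ⟨(), Set.mem_univ x⟩, 0, ⟨fun _ _ h ↦ ?_, fun _ ↦ ?_⟩, 0, 1, one_ne_zero, ?_, ?_⟩
  · simp at h
  · rw [symbolδ_zero]; exact zero_mem _
  · refine ⟨fun _ _ ↦ 0, fun J x _ ↦ ?_, fun a b _ _ ↦ ?_, fun J x _ ↦ ?_⟩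
    · simp only [map_zero, Pi.zero_apply, symbolForm_zero, ZeroMemClass.coe_zero]
    · simp only [map_zero]
    · simp only [map_zero, Pi.zero_apply, ZeroMemClass.coe_zero]
  · simp only [map_zero, Int.cast_one, one_smul]

end Nash

/-! ### What would change the verdict (prose)

* A counterexample to the FORMAL Hodge conjecture (the only way to `¬ SymbolClassesAlgebraic`, §1).
  None in sight: the `∃`-over-models encoding of `IsOfHodgeType` cannot be gamed (model independence
  `hodgePQ_independent_of_hodgeModel_holds`, uniqueness of analytification), and §11 shows the summit is
  not trivially true on the tree's carriers either (a rational non-algebraic class exists).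
* For the LINE only: `AlgebraicClassesAreNashSymbolClasses` false. Cheapest test (now runnable with
  `nash_isNashUnitOn_of_regular`): exhibit ONE non-zero Nash symbol class — `h^{q+1}` through the REGULAR
  cocycle `x_j / x_i` of `𝒪(1)` (a Hermitian metric on that algebraic presentation +
  `isTransgression_symbolCochain` + `PowerNormalisation.exists_class`). If this fails to be PROVABLE the
  Nash vocabulary is mis-typed and stub (A) is false for the wrong reason; if it succeeds, (W₁)/(W_alg)
  are non-vacuous beyond `0`. Either outcome is information the lead lacks today.
* Nothing else: every other single-hypothesis mutation of the crux and of the three stubs is either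
  proved true (band guards, `n ≤ 3`, weight 1, above the dimension), crux-strength (dropping Nash-ness),
  invisible (`IsRationalClass`, normalisation, `Fintype ι`), or refuted here (`m ≠ 0`, cover; dropping
  `IsSymbolClass` from (A)).
-/

end Summit.HodgeConjecture.HodgeConjecture.Cruxes.SymbolClassesAlgebraic.Disproof

end
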